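import Summits.ResolutionOfSingularities.ResolutionOfSingularities.Theorems.EquisingularLiftEquisingularLiftNatTCPlusMemberCentred
import HarnessLib

/-!
# [OURS · L1 W4.5(b) · EL♮(3)] HSUB(ReachTC⁺)₃ brick `inv_base` (B9): THE INVARIANT AT THE FIRST POINT STEP, `TCPlus.Inv … false`

Crux chain w45b (cell `res-hironaka`, slot W4.5(b)), working crux **EL♮** = stmt-ResolutionOfSingularities-20038, child **EL♮(3)** =
stmt-ResolutionOfSingularities-20148, route EquisingularLift, line `sections`, registered stub `stub_elnat_tcPlusPointResolution`;
assembly HSUB(ReachTC⁺)₃ of res-L1-w45b-stub-1 (driver `hsub_reachTCPlus_of_invariant` p526242, binder `hbase`; INV DEFS v3 p532383).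
HONEST FRAMING: OURS; NOT a statement of any manuscript; AI-written, weaker than expert review. No `sorry`; standard axioms.
`--supports stmt-ResolutionOfSingularities-20148 --as helper`. DEF-FREE.

WHAT. **`inv_base`** = the driver's `hbase` binder at `INV := TCPlus.Inv O k θ P q Y Ch` and relative dimension `3`: in the binders of
`tcPlus_member_uncentred` (p536594) plus the irreducibility of `T₂ = closure υ⁻¹(T₁ ∖ {x})` (driver context), for every admissible germ
`W ∋ x`: `TCPlus.Inv O k θ P q Y Ch W F₂ (𝟙 F₂) T₂ Z₂ false`, `Z₂ = υ⁻¹{x} ∩ closure υ⁻¹(W ∖ {x})` — `F₂` integral, `T₂` closed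
irreducible and not inside `closure Z₂ = Z₂ ⊆ υ⁻¹{x}` (a point of `υ⁻¹(T₁ ∖ {x}) ≠ ∅`), the uncentred member (part 1d), and at every closed
point of the reduced trace the centred member (B8 `tcPlus_member_centred`, p547231; the non-regularity hypothesis is not needed).
-/

set_option linter.dupNamespace false -- mandated namespace `Summit.<Summit>.<Problem>` of this single-conjunct summit
set_option linter.overlappingInstances false -- the binders carry `[IsDomain O] [IsDiscreteValuationRing O]`

noncomputable section

open CategoryTheory CategoryTheory.Limits AlgebraicGeometry TopologicalSpace IsLocalRing
open Literature.AlgebraicGeometry.Resolution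
open AlgebraicGeometry.Scheme.IdealSheafData
open Summit.ResolutionOfSingularities.ResolutionOfSingularities.Cruxes.EquisingularLift.StrataSplit

namespace Summit.ResolutionOfSingularities.ResolutionOfSingularities.Cruxes.EquisingularLiftNat.Sections

/-- **THE INVARIANT AT THE FIRST POINT STEP** (`TCPlus.Inv … W F₂ (𝟙 F₂) T₂ Z₂ false`, the driver's `hbase`; see the module
docstring). [cite: Matsumura1987, Thm. 14.2; StacksProject, Tag 0804] -/
theorem inv_base (k : Type) [Field k] [IsAlgClosed k] (O : Type) [CommRing O] [IsDomain O]
    [IsDiscreteValuationRing O] [IsAdicComplete (IsLocalRing.maximalIdeal O) O] [IsAlgClosed (IsLocalRing.ResidueField O)]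
    (θ : O →+* k) (hθ : Function.Surjective θ) (P : Scheme.{0}) (q : P ⟶ Spec (.of O)) (Y : Set P)
    (Ch : ∀ X' : Scheme.{0}, (X' ⟶ P) → Set X' → Prop)
    (hChSplit : ∀ (X' : Scheme.{0}) (σ' : X' ⟶ P) (S' : Set X'), Ch X' σ' S' →
      Summit.ResolutionOfSingularities.ResolutionOfSingularities.Theses.EquisingularLift.Split.Chain P Y X' σ' S')
    (hPnoeth : IsLocallyNoetherian P) (hPreg : Scheme.IsRegular P) [IsProper q]
    (X' : Scheme.{0}) (σ' : X' ⟶ P) (S' : Set X') (hCh' : Ch X' σ' S') [IsIntegral X'] [IsLocallyNoetherian X']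
    (hX'reg : Scheme.IsRegular X') (F₁ : Scheme.{0}) [IsIntegral F₁] (j : F₁ ⟶ X') (t : F₁ ⟶ Spec (.of k))
    (hsq : IsPullback j t (σ' ≫ q) (Spec.map (CommRingCat.ofHom θ))) (T₁ : Set F₁) (x : F₁) (hx : IsClosed ({x} : Set F₁))
    (U : X'.Opens) (hU : Smooth (U.ι ≫ σ' ≫ q)) (s : Spec (.of O) ⟶ X') (hs : s ≫ σ' ≫ q = 𝟙 _)
    (hsU : s (IsLocalRing.closedPoint O) ∈ U) (hsx : s (IsLocalRing.closedPoint O) = j x)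
    (hdim : ringKrullDim (X'.presheaf.stalk (s (IsLocalRing.closedPoint O))) = ((3 + 1 : ℕ) : WithBot ℕ∞))
    (hsoff : ∀ c ∈ (s.ker.support : Set X'), ¬ IsGenericPoint (σ' c) Y)
    (X₁ : Scheme.{0}) (τ₁ : X₁ ⟶ X') (hτ₁ : IsBlowup τ₁ s.ker) [IsIntegral X₁] [IsLocallyNoetherian X₁]
    (hX₁reg : Scheme.IsRegular X₁) (hX₁dom : IsDominant ((τ₁ ≫ σ') ≫ q))
    (F₂ : Scheme.{0}) [IsIntegral F₂] (υ : F₂ ⟶ F₁) (hυ : IsBlowup υ (vanishingIdeal (⟨{x}, hx⟩ : Closeds F₁)))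
    (j₂ : F₂ ⟶ X₁) (t₂ : F₂ ⟶ Spec (.of k)) (hsq₂ : IsPullback j₂ t₂ ((τ₁ ≫ σ') ≫ q) (Spec.map (CommRingCat.ofHom θ)))
    (hcomm : j₂ ≫ τ₁ = υ ≫ j) (hcarrier : (s.ker.comap τ₁).comap j₂ = (vanishingIdeal (⟨{x}, hx⟩ : Closeds F₁)).comap υ)
    (hCh₁ : Ch X₁ (τ₁ ≫ σ') (j₂ '' closure (υ ⁻¹' (T₁ \ {x}))))
    (hirr₂ : IsIrreducible (closure (υ ⁻¹' (T₁ \ {x}))))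
    (W : Set F₁) (hxW : x ∈ W) (hnot : ¬ (υ ⁻¹' {x} ⊆ closure (υ ⁻¹' (W \ {x}))))
    (hWpr : ∃ U₁ : F₁.affineOpens, x ∈ (U₁ : F₁.Opens) ∧
      ((vanishingIdeal (⟨closure W, isClosed_closure⟩ : Closeds F₁)).ideal U₁).IsPrincipal) :
    TCPlus.Inv O k θ P q Y Ch W F₂ (𝟙 F₂) (closure (υ ⁻¹' (T₁ \ {x}))) (υ ⁻¹' {x} ∩ closure (υ ⁻¹' (W \ {x}))) false := by
  have hZ : IsClosed (υ ⁻¹' {x} ∩ closure (υ ⁻¹' (W \ {x}))) := (hx.preimage υ.continuous).inter isClosed_closure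
  refine ⟨‹_›, isClosed_closure, hirr₂, fun hsub => ?_,
    tcPlus_member_uncentred k O θ hθ P q Y Ch hChSplit hPnoeth hPreg X' σ' S' hCh' hX'reg F₁ j t hsq T₁ x hx U hU s hs hsU hsx
      hdim hsoff X₁ τ₁ hτ₁ hX₁reg hX₁dom F₂ υ hυ j₂ t₂ hsq₂ hcomm hcarrier hCh₁ W hxW hnot hWpr,
    fun _ y hycl _ => ?_⟩
  · -- `T₂ ⊄ closure Z₂ = Z₂ ⊆ υ⁻¹{x}`: a point of `υ⁻¹(T₁ ∖ {x}) ≠ ∅`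
    obtain ⟨y, hyT⟩ := closure_nonempty_iff.mp hirr₂.nonempty
    have hyZ := hZ.closure_subset (hsub (subset_closure hyT))
    exact hyT.2 hyZ.1
  · -- the centred member at a closed point of the reduced trace (B8)
    refine tcPlus_member_centred k O θ hθ P q Y Ch hChSplit hPnoeth hPreg X' σ' S' hCh' hX'reg F₁ j t hsq T₁ x hx s hs hsx hdim
      hsoff X₁ τ₁ hτ₁ hX₁reg hX₁dom F₂ υ hυ j₂ t₂ hsq₂ hcomm hcarrier hCh₁ W hxW hnot hWpr _ ?_ hycl
    have hmem : ((vanishingIdeal (⟨closure (υ ⁻¹' {x} ∩ closure (υ ⁻¹' (W \ {x}))), isClosed_closure⟩ :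
        Closeds F₂)).subschemeι y : F₂) ∈ closure (υ ⁻¹' {x} ∩ closure (υ ⁻¹' (W \ {x}))) := by
      have h := Set.mem_range_self (f := fun y' => ((vanishingIdeal (⟨closure (υ ⁻¹' {x} ∩ closure (υ ⁻¹' (W \ {x}))),
        isClosed_closure⟩ : Closeds F₂)).subschemeι y' : F₂)) y
      rw [Scheme.IdealSheafData.range_subschemeι, Scheme.IdealSheafData.coe_support_vanishingIdeal] at h
      exact h
    exact hZ.closure_subset hmem

end Summit.ResolutionOfSingularities.ResolutionOfSingularities.Cruxes.EquisingularLiftNat.Sections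

end
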